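import Mathlib
import Summits.ValiantsHypothesis.ValiantsHypothesis.Theses.BarrierLever
import Summits.ValiantsHypothesis.ValiantsHypothesis.Theorems.BarrierLeverPartitionMinorsHitByVPHiddenStates

/-!
# Route BarrierLever — item `PartitionMinorsHitByVP` (stmt-ValiantsHypothesis-19717):
# the BALL–COLEX hidden family and the item modulo Conjecture Q*

Helper file (`--supports stmt-ValiantsHypothesis-19717`; cell valiant-natproofs, rung V4, 𝒟-side of
door (c); prover seat val-np-p3 gen 6). Closes NO item. One definition (`HiddenStates.BallGood`, a
Theorems-side predicate = the cell's CONJECTURE Q* for one row family; no assertion), per the director's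
standing rule «killable conjectures = Theorems-side def + falsifier, never items».

* `exists_lightest` — for an injective key on a finite type and `r ≤ |α|`, the `r` lightest elements form
  an injective family `e : Fin r → α` that is a THRESHOLD family (`key (e i) < key a` for `a ∉ range e`).
* `ballWt K k = 2^K + 2^k`, `ballKey_injective` — the additive weight whose order on `Finset (Fin K)` is
  SIZE first, then COLEX (binary); its `r` lightest subsets are the Hamming ball `B(K, s)` completed by the
  colex-initial segment of layer `s+1` — the capacity-maximal threshold family (`exists_ballColex`).
* `BallGood h K r u` — CONJECTURE Q* FOR THE FAMILY `u`: for every enumeration `e` of that threshold family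
  there is a table `tx` with `det [∏_{a ∈ u i} (tx none a + Σ_{q ∈ e k} tx (some q) a)]_{i,k} ≠ 0`.
  Numerically (exact arithmetic mod `2^61 − 1`, seat val-np-p3 g6, kit j278448): true for EVERY family at
  `h ≤ 4` (`K = h`; 65 535 families at `h = 4`), and for all sampled / structured families at `h = 5, 6, 7`,
  `K ∈ {h, h+1, 2h}` (0 failures in > 30 000 families).
* **`partitionMinorsHitByVP_of_ballGood`** — if, for all large `h`, every injective `u : Fin r → Finset (Fin h)`
  is `BallGood h h r`, then `Theses.BarrierLever.PartitionMinorsHitByVP` (with `b = 6`), by the hidden-state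
  door `HiddenStates.partitionMinor_hit_of_hiddenStates_mem` applied to `u` and to `w` against the SAME ball
  family.

WHAT THIS IS NOT: Q* is NOT proved here (nor is the item); nothing on CPM (items 20172/20195), crux 14610 or
VP vs VNP.
-/

set_option linter.dupNamespace false

namespace Summit.ValiantsHypothesis.ValiantsHypothesis.Theorems.BarrierLever.HiddenStates

open Finset Matrix
open Literature.Barriers.ValiantsHypothesis

noncomputable section

/-! ## 1. The `r` lightest elements of an injective key form a threshold family -/

/-- For an injective `key : α → ℕ` on a finite type and `r ≤ |α|`, some injective `e : Fin r → α`
enumerates elements that are all strictly lighter than every element outside its range. -/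
theorem exists_lightest {α : Type*} [Fintype α] [DecidableEq α] (key : α → ℕ)
    (hkey : Function.Injective key) (r : ℕ) (hr : r ≤ Fintype.card α) :
    ∃ e : Fin r → α, Function.Injective e ∧ ∀ a, a ∉ Set.range e → ∀ i, key (e i) < key a := by
  classical
  set S : Finset ℕ := Finset.univ.image key with hS
  have hcard : S.card = Fintype.card α := by
    rw [hS, Finset.card_image_of_injective _ hkey, Finset.card_univ]
  set g : Fin (Fintype.card α) ↪o ℕ := S.orderEmbOfFin hcard with hg
  have hpre : ∀ m : Fin (Fintype.card α), ∃ a, key a = g m := by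
    intro m
    have hm : g m ∈ S := by rw [hg]; exact S.orderEmbOfFin_mem hcard m
    obtain ⟨a, -, ha⟩ := Finset.mem_image.mp hm
    exact ⟨a, ha⟩
  choose φ hφ using hpre
  refine ⟨fun i => φ (Fin.castLE hr i), ?_, ?_⟩
  · intro i j hij
    have h1 : g (Fin.castLE hr i) = g (Fin.castLE hr j) := by
      rw [← hφ, ← hφ]
      exact congrArg key hij
    exact Fin.castLE_injective hr (g.injective h1)
  · intro a ha i
    have hmem : key a ∈ Set.range g := by
      rw [hg, Finset.range_orderEmbOfFin]
      exact Finset.mem_image_of_mem key (Finset.mem_univ a)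
    obtain ⟨m, hm⟩ := hmem
    have hrm : r ≤ (m : ℕ) := by
      by_contra hlt
      push Not at hlt
      apply ha
      refine ⟨⟨m, hlt⟩, hkey ?_⟩
      show key (φ (Fin.castLE hr ⟨m, hlt⟩)) = key a
      rw [hφ, ← hm]
      rfl
    calc key (φ (Fin.castLE hr i)) = g (Fin.castLE hr i) := hφ _
      _ < g m := g.strictMono (by
          rw [Fin.lt_def, Fin.val_castLE]
          exact lt_of_lt_of_le i.isLt hrm)
      _ = key a := hm

/-! ## 2. The ball–colex weight -/

/-- The weight of hidden state `k` among `K` states: `2^K + 2^k` (SIZE-major, then binary = colex). -/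
def ballWt (K : ℕ) (k : Fin K) : ℕ := 2 ^ K + 2 ^ (k : ℕ)

/-- The ball–colex key of a set of states: `|J|·2^K + Σ_{k∈J} 2^k`. -/
theorem sum_ballWt (K : ℕ) (J : Finset (Fin K)) :
    ∑ k ∈ J, ballWt K k = J.card * 2 ^ K + ∑ k ∈ J.map Fin.valEmbedding, 2 ^ k := by
  unfold ballWt
  rw [Finset.sum_add_distrib, Finset.sum_const, smul_eq_mul, Finset.sum_map]
  rfl

/-- The binary part is below `2^K`. -/
theorem sum_two_pow_lt (K : ℕ) (J : Finset (Fin K)) : ∑ k ∈ J.map Fin.valEmbedding, 2 ^ k < 2 ^ K :=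
  Nat.geomSum_lt (le_refl 2) fun k hk => by
    obtain ⟨k', -, rfl⟩ := Finset.mem_map.mp hk
    exact k'.isLt

/-- **The ball–colex key is injective** (size and binary expansion determine the set). -/
theorem ballKey_injective (K : ℕ) :
    Function.Injective fun J : Finset (Fin K) => ∑ k ∈ J, ballWt K k := by
  intro J J' hJJ'
  simp only [sum_ballWt] at hJJ'
  have hb := sum_two_pow_lt K J
  have hb' := sum_two_pow_lt K J'
  have hbin : ∑ k ∈ J.map Fin.valEmbedding, 2 ^ k = ∑ k ∈ J'.map Fin.valEmbedding, 2 ^ k := by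
    have hmod : (J.card * 2 ^ K + ∑ k ∈ J.map Fin.valEmbedding, 2 ^ k) % 2 ^ K =
        (J'.card * 2 ^ K + ∑ k ∈ J'.map Fin.valEmbedding, 2 ^ k) % 2 ^ K := by rw [hJJ']
    rwa [Nat.mul_comm J.card, Nat.mul_comm J'.card, Nat.mul_add_mod, Nat.mul_add_mod, Nat.mod_eq_of_lt hb,
      Nat.mod_eq_of_lt hb'] at hmod
  have hmap : J.map Fin.valEmbedding = J'.map Fin.valEmbedding := Finset.geomSum_injective (le_refl 2) hbin
  exact Finset.map_injective Fin.valEmbedding hmap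

/-- **The ball–colex threshold family exists** for every `r ≤ 2^K`: an injective `e : Fin r → Finset (Fin K)`
whose members are all lighter (for `Σ ballWt`) than every subset outside its range. -/
theorem exists_ballColex (K r : ℕ) (hr : r ≤ 2 ^ K) :
    ∃ e : Fin r → Finset (Fin K), Function.Injective e ∧
      ∀ J, J ∉ Set.range e → ∀ i, ∑ k ∈ e i, ballWt K k < ∑ k ∈ J, ballWt K k := by
  have hcard : r ≤ Fintype.card (Finset (Fin K)) := by
    rwa [Fintype.card_finset, Fintype.card_fin]
  exact exists_lightest (fun J : Finset (Fin K) => ∑ k ∈ J, ballWt K k) (ballKey_injective K) r hcard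

/-! ## 3. Conjecture Q* for one family, and the item modulo Q* -/

/-- **`BallGood h K r u` — CONJECTURE Q* of the cell for the family `u`** (Theorems-side predicate, no
assertion): against every enumeration `e` of the ball–colex threshold family of size `r` on `K` hidden
states, SOME table `tx : Option (Fin K) → Fin h → ℂ` makes the additive matrix
`[∏_{a ∈ u i} (tx none a + Σ_{q ∈ e k} tx (some q) a)]_{i,k}` nonsingular. -/
def BallGood (h K r : ℕ) (u : Fin r → Finset (Fin h)) : Prop :=
  ∀ e : Fin r → Finset (Fin K), Function.Injective e →
    (∀ J, J ∉ Set.range e → ∀ i, ∑ k ∈ e i, ballWt K k < ∑ k ∈ J, ballWt K k) →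
      ∃ tx : Option (Fin K) → Fin h → ℂ,
        (Matrix.of fun i k : Fin r => ∏ a ∈ u i, (tx none a + ∑ q ∈ e k, tx (some q) a)).det ≠ 0

/-- **Item 19717 modulo Conjecture Q*.** If for all `h ≥ h₁` every injective family of subsets of `Fin h` is
`BallGood h h r`, then `PartitionMinorsHitByVP` holds (with size exponent `b = 6`): both sides of any layout
are certified against the SAME ball–colex family with `K = h` states, and the hidden-state door applies. -/
theorem partitionMinorsHitByVP_of_ballGood (h₁ : ℕ)
    (H : ∀ h : ℕ, h₁ ≤ h → ∀ (r : ℕ) (u : Fin r → Finset (Fin h)), Function.Injective u →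
      BallGood h h r u) :
    Summit.ValiantsHypothesis.ValiantsHypothesis.Theses.BarrierLever.PartitionMinorsHitByVP := by
  refine ⟨6, max h₁ 5, fun h hh r u w hu hw => ?_⟩
  have hh₁ : h₁ ≤ h := le_trans (le_max_left _ _) hh
  have hh5 : 5 ≤ h := le_trans (le_max_right _ _) hh
  have hr : r ≤ 2 ^ h := by
    have := Fintype.card_le_of_injective u hu
    rwa [Fintype.card_fin, Fintype.card_finset, Fintype.card_fin] at this
  obtain ⟨e, he, hthr⟩ := exists_ballColex h r hr
  obtain ⟨tx, hx⟩ := H h hh₁ r u hu e he hthr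
  obtain ⟨ty, hy⟩ := H h hh₁ r w hw e he hthr
  exact partitionMinor_hit_of_hiddenStates_mem h h r hh5 (Nat.le_mul_of_pos_left h (by omega)) u w e he
    (ballWt h) hthr tx ty hx hy

/-- **Item 19717 modulo Conjecture Q\* with a variable number of hidden states.** If for all `h ≥ h₁` there is
ONE state count `Kf h ∈ [h, h·h]` such that every injective family of subsets of `Fin h` is `BallGood h (Kf h) r`, then
`PartitionMinorsHitByVP` (size exponent `b = 6`). (The tropical certificates of the cell's census need `K` slightly above `h`;
this form lets a proof of Q\* at any polynomially bounded `K ≤ h·h` close the item.) -/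
theorem partitionMinorsHitByVP_of_ballGood' (h₁ : ℕ) (Kf : ℕ → ℕ)
    (hK : ∀ h : ℕ, h₁ ≤ h → h ≤ Kf h ∧ Kf h ≤ h * h)
    (H : ∀ h : ℕ, h₁ ≤ h → ∀ (r : ℕ) (u : Fin r → Finset (Fin h)), Function.Injective u →
      BallGood h (Kf h) r u) :
    Summit.ValiantsHypothesis.ValiantsHypothesis.Theses.BarrierLever.PartitionMinorsHitByVP := by
  refine ⟨6, max h₁ 5, fun h hh r u w hu hw => ?_⟩
  have hh₁ : h₁ ≤ h := le_trans (le_max_left _ _) hh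
  have hh5 : 5 ≤ h := le_trans (le_max_right _ _) hh
  obtain ⟨hKlo, hKhi⟩ := hK h hh₁
  have hr : r ≤ 2 ^ Kf h := by
    have := Fintype.card_le_of_injective u hu
    rw [Fintype.card_fin, Fintype.card_finset, Fintype.card_fin] at this
    exact this.trans (Nat.pow_le_pow_right (by norm_num) hKlo)
  obtain ⟨e, he, hthr⟩ := exists_ballColex (Kf h) r hr
  obtain ⟨tx, hx⟩ := H h hh₁ r u hu e he hthr
  obtain ⟨ty, hy⟩ := H h hh₁ r w hw e he hthr
  exact partitionMinor_hit_of_hiddenStates_mem h (Kf h) r hh5 hKhi u w e he (ballWt (Kf h)) hthr tx ty hx hy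

/-- **Class door (pairwise form).** If BOTH families of a layout are `BallGood h K r` for one state count `K ∈ [h, h·h]`
(`h ≥ 5`), the layout is hit inside `SmallCircuits ℂ (h+h) 6`. (Convenience for class theorems: prove `BallGood` for a class
of families once, conclude for every layout with both sides in the class.) -/
theorem partitionMinor_hit_of_ballGood_pair (h K r : ℕ) (hh : 5 ≤ h) (hKlo : h ≤ K) (hKhi : K ≤ h * h)
    (u w : Fin r → Finset (Fin h)) (hu : Function.Injective u)
    (hgu : BallGood h K r u) (hgw : BallGood h K r w) :
    ∃ f ∈ SmallCircuits ℂ (h + h) 6,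
      (Matrix.of fun i j : Fin r => MvPolynomial.coeff
        (∑ a ∈ u i, Finsupp.single (Fin.castAdd h a) 1 +
          ∑ c ∈ w j, Finsupp.single (Fin.natAdd h c) 1) f).det ≠ 0 := by
  have hr : r ≤ 2 ^ K := by
    have := Fintype.card_le_of_injective u hu
    rw [Fintype.card_fin, Fintype.card_finset, Fintype.card_fin] at this
    exact this.trans (Nat.pow_le_pow_right (by norm_num) hKlo)
  obtain ⟨e, he, hthr⟩ := exists_ballColex K r hr
  obtain ⟨tx, hx⟩ := hgu e he hthr
  obtain ⟨ty, hy⟩ := hgw e he hthr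
  exact partitionMinor_hit_of_hiddenStates_mem h K r hh hKhi u w e he (ballWt K) hthr tx ty hx hy

end

end Summit.ValiantsHypothesis.ValiantsHypothesis.Theorems.BarrierLever.HiddenStates
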